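import Literature.Geometry.Lorentzian.TimeSeparationLevelFunction
import Literature.Geometry.Lorentzian.SpacelikeBoundaryFuturePoint
import Literature.Geometry.Lorentzian.RadialLengthBound
import Literature.Geometry.Lorentzian.LocalTwinParadox
import Literature.Geometry.Lorentzian.CorrespondingBoundaryDomain
import HarnessLib

/-!
# The hyperboloidal level set of the time separation through a spacelike boundary point
# (Sbierski 2016, §3.2, proof of Thm. 12: the hypersurface `S = τ_q⁻¹(τ₀)`)

J. Sbierski, Ann. Henri Poincaré 17 (2016) 301–329 = arXiv:1309.7591v3, §3.2, proof of Thm. 12.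
Given a boundary point `p` of the common development `U` with
`J⁻(p) ∩ ∂U ∩ J⁺(ι(M̄)) = {p}` (Lemma 15), a causally convex neighbourhood `W` of `p` with compact
closure inside a convex one, and (Lemma 16) a point `q ≫ p` with
`J⁻(q) ∩ Uᶜ ∩ J⁺(ι(M̄)) ⊆ W`: *"Since `W̄` is compact, `τ_q` takes on its maximum on
`W̄ ∩ Uᶜ ∩ J⁺(ι(M̄))`. Let us denote this maximum by `τ₀`. Clearly, we have `τ₀ > 0`. Moreover, one
has `τ_q(r) = τ₀` only for `r ∈ ∂U ∩ W ∩ J⁺(ι(M̄))`, since if this were not the case … one could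
continue the length maximising geodesic from `r₀` to `q` a bit to the past, staying in `W ∩ Uᶜ`,
which would lead to a longer timelike curve. We now define `S := τ_q⁻¹(τ₀) ∩ W ∩ I⁺(ι(M̄))` … `S` is
smooth … spacelike … contained in `Ū ∩ J⁺(ι(M̄))`."*

**Theorem (`LorentzianMetric.IsCauchyHypersurface.exists_levelSet_boundaryPoint`; with the
strict past side `{f < 0} ∩ O ⊆ U` added, `….exists_levelSet_boundaryPoint_sublevel`; with moreover
the temporal property `df_r(v) > 0` at every `r ∈ O`, `….exists_levelSet_boundaryPoint_temporal`),
pure causal form.** Let `S` be a Cauchy hypersurface of the strongly causal, causal spacetime `(M, g, τ)`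
(smooth metric) contained in the open `U`, in which it is a Cauchy hypersurface; assume
`J⁻(x) ∩ J⁺(S)` compact and `≤` closed. Let `p ∈ ∂U ∩ I⁺(S)` satisfy
`J⁻(p) ∩ ∂U ∩ J⁺(S) = {p}` and let `V` be a neighbourhood of `p`. Then there are a point
`p₀ ∈ V ∩ ∂U ∩ I⁺(S)`, an open `O ∋ p₀` and a function `f`, `C^∞` on `O`, with `f p₀ = 0`,
`df_{p₀}(v) > 0` for every future-directed `v`, and `{f = 0} ∩ O ⊆ Ū` — the hypotheses
(H1)–(H3) of the restart of the local uniqueness theorem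
(`Summit.FinalStateConjecture.….SubdataDevelopmentsEmbed.restart_of_locallyUnique`), (H4) being
Lemma 14 at `p₀` (`CorrespondingBoundaryExtension.lean`).

Proof, following the printed one with the tree's local time separation
(`exists_nhds_continuousOn_lorentzDist`: a uniformly normal `W ∋ p` with two-point inverse `Ξ`,
the formula `d(r, q) = |exp_q⁻¹ r|` and the continuity of `d(·, q)` on causally convex subsets):
nested neighbourhoods `A ⊆ K_c ⊆ A₂ ⊆ W ∩ V ∩ I⁺(S)` (`A`, `A₂` causally convex, `K_c` compact;
strong causality, local compactness); Lemma 16 (`exists_causalPast_inter_compl_subset`) gives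
`q₁ ≫ p`, replaced by a point `q = exp_p(ε T_p) ≪ q₁` on the future radial geodesic from `p`,
so that `d(p, q) ≥ ε|T_p| > 0` (`arcLength_expMap_smul`) while still
`K = J⁻(q) ∩ Uᶜ ∩ J⁺(S) ⊆ A`; `K` is compact and `d(·, q)` continuous on it, with maximum
`τ₀ > 0` at `p₀`; **a point `r ∈ K ∩ A` with `d(r, q) = τ₀` lies in `Ū`** (otherwise the radial
geodesic from `q` through `r`, continued to `exp_q((1+s) exp_q⁻¹ r)` in the exterior of `U` inside
`A`, is a causal curve to `q` of length `(1+s)τ₀ > τ₀` from a point of `K`); hence `p₀ ∈ ∂U`, and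
the level function `f = τ₀ - √(-g_q(exp_q⁻¹ ·, exp_q⁻¹ ·))` (`TimeSeparationLevelFunction.lean`:
smooth, with differential positive on the future cone at `p₀`) vanishes on `O` only at points of
`U` or at points `r ∈ K` with `d(r, q) = τ₀`, which lie in `Ū`.

Everything is proved; no definitions, no named facts (D-0026).

## References

* J. Sbierski, Ann. Henri Poincaré 17 (2016) 301–329 = arXiv:1309.7591v3, §3.2, proof of Thm. 12
  and Lemmas 15–16 (arXiv numbering). [Sbierski2016AHP]
* B. O'Neill, *Semi-Riemannian geometry with applications to relativity*, Academic Press 1983,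
  Ch. 5, Prop. 5.34; Ch. 14, Def. 14.15, Lemma 14.22, p. 437. [ONeillSemiRiemannian1983]
* H. Ringström, *The Cauchy Problem in General Relativity*, EMS 2009, Ch. 23. [Ringstrom2009]
-/

noncomputable section

open Bundle Set Filter Function TopologicalSpace
open scoped Manifold ContDiff Topology ENNReal

namespace Literature.Geometry.Lorentzian

open Literature.Geometry.Riemannian

variable {E : Type*} [NormedAddCommGroup E] [NormedSpace ℝ E] {H : Type*} [TopologicalSpace H]
  {I : ModelWithCorners ℝ E H} {M : Type*} [TopologicalSpace M] [ChartedSpace H M]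
  [IsManifold I ∞ M]

namespace LorentzianMetric

variable [FiniteDimensional ℝ E] [CompleteSpace E] [T2Space M] [SecondCountableTopology M]
  [I.Boundaryless] {n : ℕ∞ω} {g : LorentzianMetric I n M} [g.HasLeviCivita]
  [CovariantDerivative.ContMDiffCovariantDerivative g.leviCivita 1] (τ : TimeOrientation g)

omit [SecondCountableTopology M] in
/-- **A past timelike radial geodesic from `q` is a future causal curve to `q` of length `|v|`**:
for `v ∈ 𝓔_q` past timelike, the reversed radial curve `t ↦ exp_q((1 - t) v)` is a future
timelike curve on `[0, 1]` from `exp_q v` to `q` of length `√(-g_q(v, v))`; hence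
`d(exp_q v, q) ≥ √(-g_q(v, v))` and `exp_q v ≤ q`. O'Neill 1983, Ch. 5, Prop. 5.34.
[cite: ONeillSemiRiemannian1983, Ch. 5, Prop. 5.34 (p. 147)] -/
theorem le_lorentzDist_expMap_of_isPastDirected (hn : (∞ : ℕ∞ω) ≤ n) {q : M} {v : TangentSpace I q}
    (hv : v ∈ expDomain g.leviCivita q) (hvt : g.IsTimelike v) (hvp : τ.IsPastDirected v) :
    ENNReal.ofReal (Real.sqrt (-g.val q v v)) ≤ g.lorentzDist τ (expMap g.leviCivita q v) q ∧
      q ∈ g.causalFuture τ {expMap g.leviCivita q v} := by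
  haveI : Fact (1 ≤ n) := ⟨le_trans (by exact_mod_cast le_top) hn⟩
  set cov := g.leviCivita with hcov
  set ρ : ℝ → M := fun u ↦ expMap cov q (u • v) with hρ
  obtain ⟨hmax, h0D, -, -⟩ := maximalGeodesic_spec' (cov := cov) q v
  have h1D : (1 : ℝ) ∈ maximalGeodesicDomain cov q v := hv.2
  have hIccD : Icc (0 : ℝ) 1 ⊆ maximalGeodesicDomain cov q v := hmax.2.1.out h0D h1D
  have hrgeo : IsGeodesicOn cov ρ (maximalGeodesicDomain cov q v) :=
    isGeodesicOn_expMap_smul (cov := cov) q v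
  have hvf : τ.reverse.IsFutureDirected v := by
    rw [TimeOrientation.isFutureDirected_reverse_iff]; exact hvp
  have hρt : g.IsFutureTimelikeCurveOn τ.reverse ρ (Icc 0 1) := fun u hu ↦
    ⟨IsGeodesicOn.mdifferentiableAt_holds hrgeo (hIccD hu),
      isTimelike_isFutureDirected_velocity_expMap_smul τ.reverse hvt hvf (hIccD hu)⟩
  -- the reversed curve, future timelike from `exp_q v` to `q`
  have hρ' : g.IsFutureTimelikeCurveOn τ (fun t ↦ ρ (0 + 1 - t)) (Icc 0 1) :=
    isFutureTimelikeCurveOn_reverse_reverse_iff.1 hρt.reverseParam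
  have hρ'0 : (fun t ↦ ρ (0 + 1 - t)) 0 = expMap cov q v := by
    simp only [zero_add, sub_zero, hρ, one_smul]
  have hρ'1 : (fun t ↦ ρ (0 + 1 - t)) 1 = q := by
    simp only [zero_add, sub_self, hρ, zero_smul]; exact expMap_zero (cov := cov) q
  have hlen : g.arcLength (fun t ↦ ρ (0 + 1 - t)) 0 1 = ENNReal.ofReal (Real.sqrt (-g.val q v v)) := by
    rw [PseudoRiemannianMetric.arcLength_reverse ρ 0 1]
    exact arcLength_expMap_smul hn q hv hvt.le
  refine ⟨?_, Or.inr ⟨expMap cov q v, rfl, fun t ↦ ρ (0 + 1 - t), 0, 1, zero_lt_one,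
    hρ'.isFutureCausalCurveOn, hρ'0, hρ'1⟩⟩
  rw [← hlen]
  exact arcLength_le_lorentzDist zero_lt_one hρ'.isFutureCausalCurveOn hρ'0 hρ'1

/-- **The hyperboloidal level set through a spacelike boundary point, with its strict past side
and the temporal property on the whole neighbourhood (Sbierski 2016, proof of Thm. 12), pure
causal form.** The statement of `IsCauchyHypersurface.exists_levelSet_boundaryPoint` (see the
module docstring) with `df_r(v) > 0` for future-directed `v` at EVERY `r ∈ O` (the radial vector
`exp_q⁻¹ r` is past timelike at the points of `O` by its definition, and
`mfderiv_levelFun_pos` applies there), together with the inclusion `{f < 0} ∩ O ⊆ U`: a point `r ∈ O` with `f r < 0` has `d(r, q) = √(-Q r) > τ₀`, so it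
is not in `K = J⁻(q) ∩ Uᶜ ∩ J⁺(S)` (where `τ₀` is the maximum of `d(·, q)`), while `r ≪ q` and
`r ∈ I⁺(S)`; hence `r ∈ U`. This is the form consumed by continuation arguments in which data are
posed on the level sets `{f = -η}`, which thus lie inside `U` (the Killing development,
`Literature.Geometry.Lorentzian.fischerMarsdenMoncrief_killing_development`).
[cite: Sbierski2016AHP, §3.2, proof of Thm. 12 (arXiv numbering)]
[cite: ONeillSemiRiemannian1983, Ch. 5, Prop. 5.34; Ch. 14, Def. 14.15] -/
theorem IsCauchyHypersurface.exists_levelSet_boundaryPoint_temporal (hn : (∞ : ℕ∞ω) ≤ n)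
    (hres : PseudoRiemannianMetric.contMDiff_restrict (I := I) (n := n) (M := M))
    (hτ : τ.contMDiff_restrict) {S : Set M} (hS : g.IsCauchyHypersurface τ S) {U : Opens M}
    (hSU : S ⊆ U)
    (hU : (g.restrict hres U).IsCauchyHypersurface (τ.restrict hres hτ U) (Subtype.val ⁻¹' S))
    (hK : ∀ x : M, IsCompact (g.causalPast τ {x} ∩ g.causalFuture τ S))
    (hrel : ∀ {xs ys : ℕ → M} {x y : M}, Tendsto xs atTop (𝓝 x) → Tendsto ys atTop (𝓝 y) →
      (∀ j, ys j ∈ g.causalFuture τ {xs j}) → y ∈ g.causalFuture τ {x})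
    (hSC : g.IsStronglyCausal τ) (hcaus : g.IsCausallyWellBehaved τ)
    {p : M} (hp : p ∈ frontier (U : Set M)) (hpI : p ∈ g.chronologicalFuture τ S)
    (hsp : ∀ q ∈ g.causalPast τ {p} ∩ frontier (U : Set M) ∩ g.causalFuture τ S, q = p)
    {V : Set M} (hV : V ∈ 𝓝 p) :
    ∃ (p₀ : M) (O : Set M) (f : M → ℝ), p₀ ∈ V ∧ p₀ ∈ frontier (U : Set M) ∧
      p₀ ∈ g.chronologicalFuture τ S ∧ IsOpen O ∧ p₀ ∈ O ∧ ContMDiffOn I 𝓘(ℝ, ℝ) ∞ f O ∧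
      f p₀ = 0 ∧
      (∀ r ∈ O, ∀ v : TangentSpace I r, τ.IsFutureDirected v → (0 : ℝ) < mfderiv I 𝓘(ℝ, ℝ) f r v) ∧
      (∀ r ∈ O, f r = 0 → r ∈ closure (U : Set M)) ∧ ∀ r ∈ O, f r < 0 → r ∈ U := by
  classical
  haveI : Fact (1 ≤ n) := ⟨le_trans (by exact_mod_cast le_top) hn⟩
  haveI : LocallyCompactSpace M := Manifold.locallyCompact_of_finiteDimensional (M := M) I
  have hn2 : (2 : ℕ∞ω) ≤ n := le_trans (WithTop.coe_le_coe.mpr le_top) hn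
  have hn1 : (1 : ℕ∞ω) ≤ n := le_trans one_le_two hn2
  set cov := g.leviCivita with hcov
  have hA : g.IsAchronal τ S := IsCauchyHypersurface.isAchronal_holds hn2 hS
  have hpU : p ∉ U := fun h ↦ (eq_empty_iff_forall_notMem.1 U.2.inter_frontier_eq) _ ⟨h, hp⟩
  have hpcl : p ∈ closure (U : Set M) := frontier_subset_closure hp
  have hpS : p ∈ g.causalFuture τ S := chronologicalFuture_subset_causalFuture _ _ _ hpI
  have hchron' : g.IsChronological τ.reverse := hcaus.reverse.isChronological
  -- (1) the local time separation package at `p` and nested neighbourhoods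
  obtain ⟨W, Ξ, hWo, hpW, hWsrc, hΞs, hΞ, hform, hcontτ⟩ := exists_nhds_continuousOn_lorentzDist τ hn p
  set e := trivializationAt E (TangentSpace I : M → Type _) p with he
  set V₁ : Set M := W ∩ interior V ∩ g.chronologicalFuture τ S with hV₁
  have hV₁o : IsOpen V₁ :=
    (hWo.inter isOpen_interior).inter (isOpen_chronologicalFuture_of_boundaryless _ _ _)
  have hpV₁ : p ∈ V₁ := ⟨⟨hpW, mem_interior_iff_mem_nhds.2 hV⟩, hpI⟩
  obtain ⟨A₂, hA₂o, hpA₂, hA₂V₁, hA₂cc⟩ := hSC.exists_causallyConvex_nhds hn1 p (hV₁o.mem_nhds hpV₁)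
  obtain ⟨Kc, hKc, hKcA₂, hKcc⟩ := local_compact_nhds (hA₂o.mem_nhds hpA₂)
  obtain ⟨A, hAo, hpA, hAKc, hAcc⟩ := hSC.exists_causallyConvex_nhds hn1 p (interior_mem_nhds.2 hKc)
  have hAKc' : A ⊆ Kc := hAKc.trans interior_subset
  have hAA₂ : A ⊆ A₂ := hAKc'.trans hKcA₂
  have hA₂W : A₂ ⊆ W := fun x hx ↦ (hA₂V₁ hx).1.1
  have hAI : A ⊆ g.chronologicalFuture τ S := fun x hx ↦ (hA₂V₁ (hAA₂ hx)).2
  have hAV : A ⊆ V := fun x hx ↦ interior_subset (hA₂V₁ (hAA₂ hx)).1.2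
  have hclA : closure A ⊆ A₂ := (hKcc.isClosed.closure_subset_iff.2 hAKc').trans hKcA₂
  -- (2) Lemma 16: a point `q₁ ≫ p` with `J⁻(q₁) ∩ Uᶜ ∩ J⁺(S) ⊆ A`
  obtain ⟨q₁, hpq₁, hq₁⟩ := hS.exists_causalPast_inter_compl_subset hn2 hres hτ hSU hU hK hrel hp hsp
    (hAo.mem_nhds hpA)
  -- … replaced by `q = exp_p(ε T_p) ≪ q₁` on the future radial geodesic from `p`
  set T : TangentSpace I p := τ.vectorField p with hT
  have hTt : g.IsTimelike T := τ.isTimelike p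
  have hTf : τ.IsFutureDirected T := τ.isFutureDirected_vectorField p
  obtain ⟨hmaxT, h0DT, -, -⟩ := maximalGeodesic_spec' (cov := cov) p T
  have hcontT : ContinuousAt (fun u : ℝ ↦ expMap cov p (u • T)) 0 :=
    (IsGeodesicOn.mdifferentiableAt_holds (isGeodesicOn_expMap_smul (cov := cov) p T) h0DT).continuousAt
  have hq₁open : g.chronologicalPast τ {q₁} ∈ 𝓝 p :=
    (isOpen_chronologicalFuture_of_boundaryless _ _ _).mem_nhds
      (mem_chronologicalPast_of_mem_chronologicalFuture hpq₁)
  obtain ⟨ε, ⟨hεD, hεq₁⟩, hε⟩ : ∃ ε, (ε ∈ maximalGeodesicDomain cov p T ∧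
      expMap cov p (ε • T) ∈ g.chronologicalPast τ {q₁}) ∧ ε ∈ Ioi (0 : ℝ) := by
    have h1 : ∀ᶠ u in 𝓝 (0 : ℝ), u ∈ maximalGeodesicDomain cov p T := hmaxT.isOpen.mem_nhds h0DT
    have h2 : ∀ᶠ u in 𝓝 (0 : ℝ), expMap cov p (u • T) ∈ g.chronologicalPast τ {q₁} :=
      hcontT.preimage_mem_nhds (by
        show g.chronologicalPast τ {q₁} ∈ 𝓝 (expMap cov p ((0 : ℝ) • T))
        rw [zero_smul, expMap_zero (cov := cov) p]; exact hq₁open)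
    exact (((h1.and h2).filter_mono nhdsWithin_le_nhds).and self_mem_nhdsWithin).exists (f := 𝓝[>] 0)
  set vq : TangentSpace I p := ε • T with hvq
  have hvqdom : vq ∈ expDomain cov p := (expMap_smul_of_mem (cov := cov) p T hεD).1
  have hvqt : g.IsTimelike vq := hTt.smul (ne_of_gt hε)
  have hvqf : τ.IsFutureDirected vq := hTf.smul hε
  set q : M := expMap cov p vq with hq_def
  have hpq : q ∈ g.chronologicalFuture τ {p} := expMap_mem_chronologicalFuture τ hvqdom hvqt hvqf
  have hqq₁ : q₁ ∈ g.causalFuture τ {q} :=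
    chronologicalFuture_subset_causalFuture _ _ _ (mem_chronologicalFuture_of_mem_chronologicalPast hεq₁)
  -- `d(p, q) ≥ ε |T| > 0`
  have hdpq : 0 < g.lorentzDist τ p q := by
    have hlen : g.arcLength (fun s : ℝ ↦ expMap cov p (s • vq)) 0 1 =
        ENNReal.ofReal (Real.sqrt (-g.val p vq vq)) := arcLength_expMap_smul hn p hvqdom hvqt.le
    obtain ⟨hmaxq, h0Dq, -, -⟩ := maximalGeodesic_spec' (cov := cov) p vq
    have hIccq : Icc (0 : ℝ) 1 ⊆ maximalGeodesicDomain cov p vq := hmaxq.2.1.out h0Dq hvqdom.2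
    have hcurve : g.IsFutureCausalCurveOn τ (fun s : ℝ ↦ expMap cov p (s • vq)) (Icc 0 1) :=
      fun s hs ↦ ⟨IsGeodesicOn.mdifferentiableAt_holds (isGeodesicOn_expMap_smul (cov := cov) p vq)
        (hIccq hs), (isTimelike_isFutureDirected_velocity_expMap_smul τ hvqt hvqf (hIccq hs)).2⟩
    have hle := arcLength_le_lorentzDist zero_lt_one hcurve
      (by show expMap cov p ((0 : ℝ) • vq) = p; rw [zero_smul]; exact expMap_zero (cov := cov) p)
      (by show expMap cov p ((1 : ℝ) • vq) = q; rw [one_smul])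
    rw [hlen] at hle
    refine lt_of_lt_of_le ?_ hle
    rw [ENNReal.ofReal_pos, Real.sqrt_pos]
    exact neg_pos.2 hvqt
  -- (3) the compact set `K = J⁻(q) ∩ Uᶜ ∩ J⁺(S) ⊆ A`
  set Kset : Set M := g.causalPast τ {q} ∩ (U : Set M)ᶜ ∩ g.causalFuture τ S with hKset
  have hKA : Kset ⊆ A := fun x hx ↦ hq₁ ⟨⟨mem_causalPast_singleton_iff.2
    (mem_causalFuture_of_mem_causalFuture_of_mem_causalFuture hn2 (mem_causalPast_singleton_iff.1 hx.1.1)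
      hqq₁), hx.1.2⟩, hx.2⟩
  have hKcpt : IsCompact Kset := by
    have h1 : Kset ⊆ g.causalPast τ {q} ∩ g.causalFuture τ S := fun x hx ↦ ⟨hx.1.1, hx.2⟩
    refine (hK q).of_isClosed_subset ?_ h1
    have h2 : Kset = (g.causalPast τ {q} ∩ g.causalFuture τ S) ∩ (U : Set M)ᶜ := by
      ext x; simp only [hKset, mem_inter_iff, mem_compl_iff]; tauto
    rw [h2]
    exact (hK q).isClosed.inter U.isOpen.isClosed_compl
  -- `p`, `q ∈ K ⊆ A`
  have hqU : q ∉ U := fun hqU ↦ hpU (hA.mem_opens_of_mem_chronologicalFuture hn2 hres hτ hU hpS hqU hpq)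
  have hqS : q ∈ g.causalFuture τ S :=
    chronologicalFuture_subset_causalFuture _ _ _ (mem_chronologicalFuture_trans hpI hpq)
  have hqK : q ∈ Kset := ⟨⟨subset_causalFuture (g := g) (τ := τ.reverse) _ rfl, hqU⟩, hqS⟩
  have hpK : p ∈ Kset :=
    ⟨⟨mem_causalPast_singleton_iff.2 (chronologicalFuture_subset_causalFuture _ _ _ hpq), hpU⟩, hpS⟩
  have hqA : q ∈ A := hKA hqK
  have hqA₂ : q ∈ A₂ := hAA₂ hqA
  have hqW : q ∈ W := hA₂W hqA₂
  -- (4) the time separation to `q`, continuous on `A₂`, and its maximum `τ₀` on `K`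
  set d : M → ℝ≥0∞ := fun r ↦ g.lorentzDist τ r q with hd
  have hdcont : ContinuousOn d Kset := (hcontτ hcaus A₂ hA₂o hA₂W hA₂cc q hqA₂).mono (hKA.trans hAA₂)
  obtain ⟨p₀, hp₀K, hmax⟩ := hKcpt.exists_isMaxOn ⟨p, hpK⟩ hdcont
  set τ₀ : ℝ≥0∞ := d p₀ with hτ₀
  have hτ₀pos : 0 < τ₀ := lt_of_lt_of_le hdpq (hmax hpK)
  have hdqq : d q = 0 := lorentzDist_self_of_isCausallyWellBehaved hcaus q
  -- the local formula at a point `r ≠ q` of `A₂ ∩ J⁻(q)`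
  have hformula : ∀ r ∈ A₂, r ∈ g.causalPast τ {q} → r ≠ q →
      (g.val q (e.symmL ℝ q (Ξ q r)) (e.symmL ℝ q (Ξ q r)) ≤ 0 ∧
        0 < g.val q (τ.vectorField q) (e.symmL ℝ q (Ξ q r))) ∧
      d r = ENNReal.ofReal (Real.sqrt (-g.val q (e.symmL ℝ q (Ξ q r)) (e.symmL ℝ q (Ξ q r)))) := by
    intro r hrA₂ hrq hne
    obtain ⟨-, hw, -, hd₂⟩ := hform A₂ hA₂W hA₂cc r hrA₂ q hqA₂ (mem_causalPast_singleton_iff.1 hrq)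
      hne.symm
    exact ⟨hw, hd₂⟩
  -- (5) a point `r ∈ K ∩ A` with `d(r, q) = τ₀` lies in `Ū`
  have hext : ∀ r ∈ Kset, d r = τ₀ → r ∈ closure (U : Set M) := by
    intro r hrK hdr
    by_contra hrcl
    have hrA : r ∈ A := hKA hrK
    have hne : r ≠ q := fun h ↦ by rw [h, hdqq] at hdr; exact hτ₀pos.ne hdr
    obtain ⟨⟨hwle, hwT⟩, hdform⟩ := hformula r (hAA₂ hrA) hrK.1.1 hne
    set w : TangentSpace I q := e.symmL ℝ q (Ξ q r) with hw_def
    have hwdom : w ∈ expDomain cov q := (hΞ q hqW r (hA₂W (hAA₂ hrA))).1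
    have hwexp : expMap cov q w = r := (hΞ q hqW r (hA₂W (hAA₂ hrA))).2
    -- `w` is past timelike, `|w| = τ₀ > 0`
    set x : ℝ := Real.sqrt (-g.val q w w) with hx
    have hxpos : 0 < x := by
      have h : 0 < ENNReal.ofReal x := by rw [← hdform, hdr]; exact hτ₀pos
      exact ENNReal.ofReal_pos.1 h
    have hwt : g.IsTimelike w := by
      have h := Real.sqrt_pos.1 hxpos
      show g.val q w w < 0
      linarith
    have hwp : τ.IsPastDirected w := ⟨hwt.isCausal, hwT⟩
    -- continue the radial geodesic a bit beyond `r`, inside `A ∩ (Ū)ᶜ`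
    obtain ⟨hmaxw, h0Dw, -, -⟩ := maximalGeodesic_spec' (cov := cov) q w
    have h1Dw : (1 : ℝ) ∈ maximalGeodesicDomain cov q w := hwdom.2
    have hcont1 : ContinuousAt (fun u : ℝ ↦ expMap cov q (u • w)) 1 :=
      (IsGeodesicOn.mdifferentiableAt_holds (isGeodesicOn_expMap_smul (cov := cov) q w) h1Dw).continuousAt
    obtain ⟨u, ⟨huD, huA, hucl⟩, hu⟩ : ∃ u, (u ∈ maximalGeodesicDomain cov q w ∧
        expMap cov q (u • w) ∈ A ∧ expMap cov q (u • w) ∈ (closure (U : Set M))ᶜ) ∧ u ∈ Ioi (1 : ℝ) := by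
      have h1 : ∀ᶠ u in 𝓝 (1 : ℝ), u ∈ maximalGeodesicDomain cov q w := hmaxw.isOpen.mem_nhds h1Dw
      have hbase : expMap cov q ((1 : ℝ) • w) = r := by rw [one_smul]; exact hwexp
      have h2 : ∀ᶠ u in 𝓝 (1 : ℝ), expMap cov q (u • w) ∈ A :=
        hcont1.preimage_mem_nhds (by rw [hbase]; exact hAo.mem_nhds hrA)
      have h3 : ∀ᶠ u in 𝓝 (1 : ℝ), expMap cov q (u • w) ∈ (closure (U : Set M))ᶜ :=
        hcont1.preimage_mem_nhds (by rw [hbase]; exact isClosed_closure.isOpen_compl.mem_nhds hrcl)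
      exact ((((h1.and h2).and h3).filter_mono nhdsWithin_le_nhds).and self_mem_nhdsWithin
        |>.mono fun u hu ↦ ⟨⟨hu.1.1.1, hu.1.1.2, hu.1.2⟩, hu.2⟩).exists (f := 𝓝[>] 1)
    have hupos : 0 < u := lt_trans zero_lt_one hu
    set vu : TangentSpace I q := u • w with hvu
    have hvudom : vu ∈ expDomain cov q := (expMap_smul_of_mem (cov := cov) q w huD).1
    have hvut : g.IsTimelike vu := hwt.smul hupos.ne'
    have hvup : τ.IsPastDirected vu := ⟨hvut.isCausal, by
      show 0 < g.val q (τ.vectorField q) (u • w); rw [map_smul]; exact mul_pos hupos hwT⟩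
    obtain ⟨hle, hqr'⟩ := le_lorentzDist_expMap_of_isPastDirected τ hn hvudom hvut hvup
    -- `exp_q(u w) ∈ K`, so `d ≤ τ₀`; but the radial length is `u τ₀ > τ₀`
    have hr'K : expMap cov q vu ∈ Kset :=
      ⟨⟨mem_causalPast_singleton_iff.2 hqr', fun h ↦ hucl (subset_closure h)⟩,
        chronologicalFuture_subset_causalFuture _ _ _ (hAI huA)⟩
    have hle' : d (expMap cov q vu) ≤ τ₀ := hmax hr'K
    have hlen : Real.sqrt (-g.val q vu vu) = u * x := by
      have h1 : g.val q vu vu = u * u * g.val q w w := by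
        have h2 : g.val q vu vu = u • ((u • g.val q w) w) := by
          show g.val q (u • w) (u • w) = _
          rw [map_smul, map_smul]
        rw [h2]
        show u • (u • g.val q w w) = u * u * g.val q w w
        rw [smul_eq_mul, smul_eq_mul]; ring
      rw [h1, show -(u * u * g.val q w w) = (u * u) * (-g.val q w w) by ring,
        Real.sqrt_mul (mul_nonneg hupos.le hupos.le), Real.sqrt_mul_self hupos.le]
    have hlt : τ₀ < ENNReal.ofReal (Real.sqrt (-g.val q vu vu)) := by
      rw [hlen, ← hdr, hdform, ENNReal.ofReal_lt_ofReal_iff (mul_pos hupos hxpos)]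
      have : 1 * x < u * x := mul_lt_mul_of_pos_right hu hxpos
      linarith
    exact absurd (lt_of_lt_of_le hlt (hle.trans hle')) (lt_irrefl _)
  -- (6) `p₀ ∈ ∂U ∩ I⁺(S) ∩ V`, `p₀ ≠ q`, and its radial vector `w₀` is past timelike
  have hp₀A : p₀ ∈ A := hKA hp₀K
  have hp₀cl : p₀ ∈ closure (U : Set M) := hext p₀ hp₀K rfl
  have hp₀fr : p₀ ∈ frontier (U : Set M) := ⟨hp₀cl, by rw [U.isOpen.interior_eq]; exact hp₀K.1.2⟩
  have hp₀ne : p₀ ≠ q := fun h ↦ by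
    have : τ₀ = 0 := by rw [hτ₀, h]; exact hdqq
    exact hτ₀pos.ne' this
  obtain ⟨⟨hw₀le, hw₀T⟩, hd₀⟩ := hformula p₀ (hAA₂ hp₀A) hp₀K.1.1 hp₀ne
  set w₀ : TangentSpace I q := e.symmL ℝ q (Ξ q p₀) with hw₀
  set τ₀r : ℝ := Real.sqrt (-g.val q w₀ w₀) with hτ₀r
  have hτ₀rpos : 0 < τ₀r := by
    have h : 0 < ENNReal.ofReal τ₀r := by rw [← hd₀]; exact hτ₀pos
    exact ENNReal.ofReal_pos.1 h
  have hw₀t : g.IsTimelike w₀ := by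
    have h := Real.sqrt_pos.1 hτ₀rpos
    show g.val q w₀ w₀ < 0
    linarith
  have hw₀p : τ.IsPastDirected w₀ := ⟨hw₀t.isCausal, hw₀T⟩
  -- (7) the level function `f` and the open set `O`
  set wf : M → E := fun r ↦ (e.symmL ℝ q : E →L[ℝ] E) (Ξ q r) with hwf
  set Q : M → ℝ := fun r ↦ g.val q (e.symmL ℝ q (Ξ q r)) (e.symmL ℝ q (Ξ q r)) with hQ
  set P : M → ℝ := fun r ↦ g.val q (τ.vectorField q) (e.symmL ℝ q (Ξ q r)) with hP
  set f : M → ℝ := fun r ↦ τ₀r - Real.sqrt (-Q r) with hf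
  have hwfs : ContMDiffOn I 𝓘(ℝ, E) ∞ wf W := contMDiffOn_clm_twoPoint _ hΞs hqW
  have hQc : ContinuousOn Q W := by
    let B : E →L[ℝ] E →L[ℝ] ℝ := g.val q
    have hB' : Continuous (fun u : E ↦ B u u) := B.continuous₂.comp (continuous_id.prodMk continuous_id)
    exact hB'.comp_continuousOn hwfs.continuousOn
  have hPc : ContinuousOn P W :=
    (g.val q (τ.vectorField q)).continuous.comp_continuousOn hwfs.continuousOn
  set O : Set M := A ∩ (W ∩ Q ⁻¹' Iio 0) ∩ (W ∩ P ⁻¹' Ioi 0) with hO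
  have hOo : IsOpen O :=
    (hAo.inter (hQc.isOpen_inter_preimage hWo isOpen_Iio)).inter (hPc.isOpen_inter_preimage hWo isOpen_Ioi)
  have hp₀W : p₀ ∈ W := hA₂W (hAA₂ hp₀A)
  have hp₀O : p₀ ∈ O := ⟨⟨hp₀A, hp₀W, hw₀t⟩, hp₀W, hw₀T⟩
  have hfs : ContMDiffOn I 𝓘(ℝ, ℝ) ∞ f O :=
    (contMDiffOn_levelFun (g := g) p hWo hΞs hqW τ₀r).mono fun r hr ↦ ⟨hr.1.2.1, hr.1.2.2⟩
  refine ⟨p₀, O, f, hAV hp₀A, hp₀fr, hAI hp₀A, hOo, hp₀O, hfs, ?_, ?_, ?_, ?_⟩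
  · -- `f p₀ = 0`
    show τ₀r - Real.sqrt (-Q p₀) = 0
    exact sub_self _
  · -- (H2) the differential on the future cone, at every point of `O` (where the radial vector
    -- `w_r` is past timelike by the definition of `O`)
    intro r hrO v hv
    have hrW : r ∈ W := hrO.1.2.1
    have hwrt : g.IsTimelike (x := q) (e.symmL ℝ q (Ξ q r)) := hrO.1.2.2
    have hwrp : τ.IsPastDirected (x := q) (e.symmL ℝ q (Ξ q r)) := ⟨hwrt.isCausal, hrO.2.2⟩
    exact mfderiv_levelFun_pos τ hn p hWo hΞs hΞ hqW hrW hwrt hwrp τ₀r hv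
  · -- (H3) the level set lies in `Ū`
    intro r hrO hfr
    by_cases hrU : r ∈ U
    · exact subset_closure hrU
    have hrA : r ∈ A := hrO.1.1
    have hrW : r ∈ W := hrO.1.2.1
    have hQr : Q r < 0 := hrO.1.2.2
    have hPr : 0 < P r := hrO.2.2
    set wr : TangentSpace I q := e.symmL ℝ q (Ξ q r) with hwr
    have hwrdom : wr ∈ expDomain cov q := (hΞ q hqW r hrW).1
    have hwrexp : expMap cov q wr = r := (hΞ q hqW r hrW).2
    have hwrt : g.IsTimelike wr := hQr
    have hwrf : τ.reverse.IsFutureDirected wr := by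
      rw [TimeOrientation.isFutureDirected_reverse_iff]; exact ⟨hwrt.isCausal, hPr⟩
    -- `r ≪ q` along the radial geodesic, in particular `r ≠ q` and `r ∈ K`
    have hrq : r ∈ g.chronologicalPast τ {q} := by
      have h := expMap_mem_chronologicalFuture τ.reverse hwrdom hwrt hwrf
      rwa [hwrexp] at h
    have hne : r ≠ q := fun h ↦ (isChronological_iff.mp hchron' q) (by rw [h] at hrq; exact hrq)
    have hrK : r ∈ Kset := ⟨⟨chronologicalFuture_subset_causalFuture _ _ _ hrq, hrU⟩,
      chronologicalFuture_subset_causalFuture _ _ _ (hAI hrA)⟩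
    -- `d(r, q) = √(-Q r) = τ₀r`, i.e. `= τ₀`
    obtain ⟨-, hdform⟩ := hformula r (hAA₂ hrA) hrK.1.1 hne
    have hsq : Real.sqrt (-Q r) = τ₀r := by
      have h : τ₀r - Real.sqrt (-Q r) = 0 := hfr
      linarith
    have hdr : d r = τ₀ := by
      rw [hdform]
      show ENNReal.ofReal (Real.sqrt (-Q r)) = τ₀
      rw [hsq, hτ₀, hd₀]
    exact hext r hrK hdr
  · -- the strict sublevel set lies in `U`
    intro r hrO hfr
    by_contra hrU
    have hrA : r ∈ A := hrO.1.1
    have hrW : r ∈ W := hrO.1.2.1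
    have hQr : Q r < 0 := hrO.1.2.2
    have hPr : 0 < P r := hrO.2.2
    set wr : TangentSpace I q := e.symmL ℝ q (Ξ q r) with hwr
    have hwrdom : wr ∈ expDomain cov q := (hΞ q hqW r hrW).1
    have hwrexp : expMap cov q wr = r := (hΞ q hqW r hrW).2
    have hwrt : g.IsTimelike wr := hQr
    have hwrf : τ.reverse.IsFutureDirected wr := by
      rw [TimeOrientation.isFutureDirected_reverse_iff]; exact ⟨hwrt.isCausal, hPr⟩
    -- `r ≪ q` along the radial geodesic, in particular `r ≠ q`; were `r ∉ U`, then `r ∈ K`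
    have hrq : r ∈ g.chronologicalPast τ {q} := by
      have h := expMap_mem_chronologicalFuture τ.reverse hwrdom hwrt hwrf
      rwa [hwrexp] at h
    have hne : r ≠ q := fun h ↦ (isChronological_iff.mp hchron' q) (by rw [h] at hrq; exact hrq)
    have hrK : r ∈ Kset := ⟨⟨chronologicalFuture_subset_causalFuture _ _ _ hrq, hrU⟩,
      chronologicalFuture_subset_causalFuture _ _ _ (hAI hrA)⟩
    -- but `d(r, q) = √(-Q r) > τ₀r`, against the maximality of `τ₀ = d(p₀, q)` on `K`
    obtain ⟨-, hdform⟩ := hformula r (hAA₂ hrA) hrK.1.1 hne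
    have hlt : τ₀r < Real.sqrt (-Q r) := by
      have h : τ₀r - Real.sqrt (-Q r) < 0 := hfr
      linarith
    have hdr : τ₀ < d r := by
      rw [hdform, hτ₀, hd₀]
      show ENNReal.ofReal τ₀r < ENNReal.ofReal (Real.sqrt (-Q r))
      exact (ENNReal.ofReal_lt_ofReal_iff (lt_trans hτ₀rpos hlt)).2 hlt
    exact absurd (hmax hrK) (not_le.2 hdr)

/-- **The hyperboloidal level set through a spacelike boundary point, with its strict past side**:
`exists_levelSet_boundaryPoint_temporal` with the temporal property only at `p₀`.
[cite: Sbierski2016AHP, §3.2, proof of Thm. 12 (arXiv numbering)]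
[cite: ONeillSemiRiemannian1983, Ch. 5, Prop. 5.34; Ch. 14, Def. 14.15] -/
theorem IsCauchyHypersurface.exists_levelSet_boundaryPoint_sublevel (hn : (∞ : ℕ∞ω) ≤ n)
    (hres : PseudoRiemannianMetric.contMDiff_restrict (I := I) (n := n) (M := M))
    (hτ : τ.contMDiff_restrict) {S : Set M} (hS : g.IsCauchyHypersurface τ S) {U : Opens M}
    (hSU : S ⊆ U)
    (hU : (g.restrict hres U).IsCauchyHypersurface (τ.restrict hres hτ U) (Subtype.val ⁻¹' S))
    (hK : ∀ x : M, IsCompact (g.causalPast τ {x} ∩ g.causalFuture τ S))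
    (hrel : ∀ {xs ys : ℕ → M} {x y : M}, Tendsto xs atTop (𝓝 x) → Tendsto ys atTop (𝓝 y) →
      (∀ j, ys j ∈ g.causalFuture τ {xs j}) → y ∈ g.causalFuture τ {x})
    (hSC : g.IsStronglyCausal τ) (hcaus : g.IsCausallyWellBehaved τ)
    {p : M} (hp : p ∈ frontier (U : Set M)) (hpI : p ∈ g.chronologicalFuture τ S)
    (hsp : ∀ q ∈ g.causalPast τ {p} ∩ frontier (U : Set M) ∩ g.causalFuture τ S, q = p)
    {V : Set M} (hV : V ∈ 𝓝 p) :
    ∃ (p₀ : M) (O : Set M) (f : M → ℝ), p₀ ∈ V ∧ p₀ ∈ frontier (U : Set M) ∧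
      p₀ ∈ g.chronologicalFuture τ S ∧ IsOpen O ∧ p₀ ∈ O ∧ ContMDiffOn I 𝓘(ℝ, ℝ) ∞ f O ∧
      f p₀ = 0 ∧ (∀ v : TangentSpace I p₀, τ.IsFutureDirected v → (0 : ℝ) < mfderiv I 𝓘(ℝ, ℝ) f p₀ v) ∧
      (∀ r ∈ O, f r = 0 → r ∈ closure (U : Set M)) ∧ ∀ r ∈ O, f r < 0 → r ∈ U := by
  obtain ⟨p₀, O, f, h1, h2, h3, h4, h5, h6, h7, h8, h9, h10⟩ :=
    hS.exists_levelSet_boundaryPoint_temporal τ hn hres hτ hSU hU hK hrel hSC hcaus hp hpI hsp hV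
  exact ⟨p₀, O, f, h1, h2, h3, h4, h5, h6, h7, h8 p₀ h5, h9, h10⟩

/-- **The hyperboloidal level set through a spacelike boundary point (Sbierski 2016, proof of
Thm. 12), pure causal form.** See the module docstring for the statement, the proof and the role
of the output (hypotheses (H1)–(H3) of the restart of the local uniqueness theorem); this is
`exists_levelSet_boundaryPoint_sublevel` without its last clause.
[cite: Sbierski2016AHP, §3.2, proof of Thm. 12 (arXiv numbering)]
[cite: ONeillSemiRiemannian1983, Ch. 5, Prop. 5.34; Ch. 14, Def. 14.15] -/
theorem IsCauchyHypersurface.exists_levelSet_boundaryPoint (hn : (∞ : ℕ∞ω) ≤ n)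
    (hres : PseudoRiemannianMetric.contMDiff_restrict (I := I) (n := n) (M := M))
    (hτ : τ.contMDiff_restrict) {S : Set M} (hS : g.IsCauchyHypersurface τ S) {U : Opens M}
    (hSU : S ⊆ U)
    (hU : (g.restrict hres U).IsCauchyHypersurface (τ.restrict hres hτ U) (Subtype.val ⁻¹' S))
    (hK : ∀ x : M, IsCompact (g.causalPast τ {x} ∩ g.causalFuture τ S))
    (hrel : ∀ {xs ys : ℕ → M} {x y : M}, Tendsto xs atTop (𝓝 x) → Tendsto ys atTop (𝓝 y) →
      (∀ j, ys j ∈ g.causalFuture τ {xs j}) → y ∈ g.causalFuture τ {x})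
    (hSC : g.IsStronglyCausal τ) (hcaus : g.IsCausallyWellBehaved τ)
    {p : M} (hp : p ∈ frontier (U : Set M)) (hpI : p ∈ g.chronologicalFuture τ S)
    (hsp : ∀ q ∈ g.causalPast τ {p} ∩ frontier (U : Set M) ∩ g.causalFuture τ S, q = p)
    {V : Set M} (hV : V ∈ 𝓝 p) :
    ∃ (p₀ : M) (O : Set M) (f : M → ℝ), p₀ ∈ V ∧ p₀ ∈ frontier (U : Set M) ∧
      p₀ ∈ g.chronologicalFuture τ S ∧ IsOpen O ∧ p₀ ∈ O ∧ ContMDiffOn I 𝓘(ℝ, ℝ) ∞ f O ∧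
      f p₀ = 0 ∧ (∀ v : TangentSpace I p₀, τ.IsFutureDirected v → (0 : ℝ) < mfderiv I 𝓘(ℝ, ℝ) f p₀ v) ∧
      ∀ r ∈ O, f r = 0 → r ∈ closure (U : Set M) := by
  obtain ⟨p₀, O, f, h1, h2, h3, h4, h5, h6, h7, h8, h9, -⟩ :=
    hS.exists_levelSet_boundaryPoint_sublevel τ hn hres hτ hSU hU hK hrel hSC hcaus hp hpI hsp hV
  exact ⟨p₀, O, f, h1, h2, h3, h4, h5, h6, h7, h8, h9⟩

end LorentzianMetric

end Literature.Geometry.Lorentzian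

end
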